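import Literature.Analysis.FluidPDE.DifferentiableGaussGreen
import Literature.Analysis.FluidPDE.LeiZhang2011
import Literature.Analysis.FluidPDE.BMOInvAnnihilator
import HarnessLib

/-!
# Lei–Zhang 2011, Theorem 1.4: the endgame of both cases of the printed proof
# (a `BMO` stream function kills every spatially constant flow)

Analysis/FluidPDE **proofs file** (theorems only: no definitions, no named facts, no `sorry`) on
the discharge path of the named fact
`Literature.Analysis.FluidPDE.LeiZhang2011_regularity_bmoStream` (Z. Lei, Q. S. Zhang,
*A Liouville theorem for the axially-symmetric Navier–Stokes equations*, J. Funct. Anal. 261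
(2011) 2323–2345 = arXiv:1011.5066, **Theorem 1.4**; proof §4, arXiv pp. 12–13), companion of
`LeiZhang2011Proofs.lean` (Theorem 1.2, steps (2)–(3)).

The printed proof of Theorem 1.4 argues by contradiction at a first (axis) singular point and
blows up to a bounded ancient solution `u` with `|u(0,0)| = 1`; in **Case 1** Theorem 1.1 and
KNSS Thm. 5.2 reduce `u` to `(0, 0, l(t))`, in **Case 2** the identity `(ν⊥·∇)u = 0` and KNSS
Thm. 5.1 reduce it to `u = u^r(t) ν + u^z(t) e_z` — in both cases a flow that is *constant in
space*, in Case 2 along an arbitrary direction — and both cases end with "the boundedness of the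
stream function of `u` in BMO norm implies that `u = 0`" (p. 13). This file proves that endgame
for an arbitrary constant vector and in the two forms a formal blow-up argument needs:

* `eq_zero_of_forall_integral_mul_inner_eq` — **distributional form**: if `B` is locally
  integrable with `‖B‖_{BMO} < ∞` (`eBMOSeminormVec`) and `curl B = b` in `𝓓'` for a constant
  vector `b` (the identity `∫ φ ⟪b, e⟫ = ∫ ⟪B × ∇φ, e⟫`, the shape produced by
  `integral_mul_inner_eq_integral_inner_cross_gradient` of `DifferentiableGaussGreen` and the one
  that survives weak limits of rescaled stream functions), then `b = 0`. Proof: `⟪b, e⟫` is the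
  weak divergence of the field `B × e`, whose components are `BMO`; a weakly harmonic element of
  `BMO⁻¹ = div BMO` vanishes (Liouville in `BMO⁻¹`,
  `HasWeakDivergenceRepresentation.ae_eq_zero_of_weaklyHarmonic`, `BMOInvAnnihilator`). As in
  `LeiZhang2011Proofs`, this replaces the printed "`B` is harmonic, hence bounded, hence
  constant" (which uses `div B = 0`); no gauge condition is needed.
* `eq_zero_of_curl_ae_eq_const_of_eBMOSeminormVec_lt_top` — **the stream class of the fact**:
  `B` differentiable, `curl B = b` a.e., `‖B‖_{BMO} < ∞` ⇒ `b = 0` (any direction `b`; the axial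
  case `b = l e_z` is `eq_zero_of_ae_curl_apply_two_eq_of_eBMOSeminormVec_le` of
  `LeiZhang2011Proofs`, proved there by a direct cut-off estimate).
* `HasBMOStreamFunctionOn.eq_zero_of_ae_eq_const`,
  `HasBMOStreamFunctionOn.ae_eq_zero_of_ae_eq_const`, `ae_eq_zero_of_ae_eq_const_of_bmoStream`
  — the same for the hypothesis class
  `HasBMOStreamFunctionOn` of `LeiZhang2011_regularity_bmoStream` and in the a.e.-in-time shape
  in which KNSS Thms. 5.1/5.2 (`KNSS2009_liouville_planar`, `…_axisymmetric_no_swirl`) deliver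
  their conclusions.
* helpers: `memBMO_inner_of_eBMOSeminormVec_lt_top` (components of a field of finite vector
  `BMO` seminorm are `BMO`), `integral_laplacian_eq_zero_of_isTestFunctionOn` (`∫ Δθ = 0`).

What is *not* here (and keeps the fact open, size XL): Theorem 1.1 of the paper (Hölder
continuity of `Γ = r v^θ` at the axis for drifts in the class `E`, §§2–3), the blow-up procedure
at a first axis singular point with a limit inheriting axisymmetry, the `BMO` stream bound and
the bound on `Γ`, and the maximum principle for `Γ` used in Case 2.

## Mathlib / tree search

Reused: `integral_mul_inner_eq_integral_inner_cross_gradient`, `inner_cross_left_swap`,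
`inner_cross_right_eq_inner_cross_left` (`DifferentiableGaussGreen`), `integral_divergence_eq_zero`
(`WholeSpaceIBP`), `divergence_gradient` (`PressurePoisson`), `locallyIntegrable_inner_const`
(`BMOCarleson`), `eBMOSeminorm_const_mul_le`, `eBMOSeminorm_zero` (`BMOInvProofs`),
`HasWeakDivergenceRepresentation.ae_eq_zero_of_weaklyHarmonic` (`BMOInvAnnihilator`).
`LeiZhang2011Proofs.lean` (landed while this file was written) has the axial special case and
Theorem 1.2 for swirl-free solutions; nothing there is restated here.

## References

* Z. Lei, Q. S. Zhang, J. Funct. Anal. 261 (2011) 2323–2345 = arXiv:1011.5066: Thm. 1.4 (p. 4),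
  proof §4, Cases 1–2 (pp. 12–13). [LeiZhang2011]
* G. Koch, N. Nadirashvili, G. Seregin, V. Šverák, Acta Math. 203 (2009) 83–105, Thms. 5.1–5.2.
  [KochNadirashviliSereginSverak2009]
* P. G. Lemarié-Rieusset, *The Navier–Stokes problem in the 21st century* (2016), Def. 6.4
  (Liouville in `BMO⁻¹`). [LemarieRieusset2016]
-/

noncomputable section

open MeasureTheory Set Function Filter Topology TopologicalSpace Metric
open scoped InnerProductSpace RealInnerProductSpace NNReal ENNReal Laplacian

namespace Literature.Analysis.FluidPDE

open Literature.Analysis.FunctionSpaces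

/-! ### `BMO` stream functions rule out the parasitic (constant-in-space) flows -/

/-- Components of a field with finite vector `BMO` seminorm are `BMO` functions: for every
`u ∈ ℝ³`, `x ↦ ⟪B x, u⟫` is in `BMO` when `B` is locally integrable with `‖B‖_{BMO} < ∞`
(homogeneity of the seminorm, `eBMOSeminorm_const_mul_le`). [folklore] -/
theorem memBMO_inner_of_eBMOSeminormVec_lt_top
    {B : EuclideanSpace ℝ (Fin 3) → EuclideanSpace ℝ (Fin 3)} (hBi : LocallyIntegrable B volume)
    (hBMO : eBMOSeminormVec B < ∞) (u : EuclideanSpace ℝ (Fin 3)) :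
    MemBMO (fun x => ⟪B x, u⟫) volume := by
  refine ⟨locallyIntegrable_inner_const hBi u, ?_⟩
  by_cases hu : u = 0
  · subst hu
    have : (fun x => ⟪B x, (0 : EuclideanSpace ℝ (Fin 3))⟫) = (0 : EuclideanSpace ℝ (Fin 3) → ℝ) :=
      funext fun x => by simp
    rw [this, eBMOSeminorm_zero]
    exact ENNReal.zero_lt_top
  · set u' : (EuclideanSpace ℝ (Fin 3)) := ‖u‖⁻¹ • u with hu'
    have hnorm : ‖u'‖ ≤ 1 := by
      rw [hu', norm_smul, norm_inv, norm_norm, inv_mul_cancel₀ (norm_ne_zero_iff.2 hu)]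
    have heq : (fun x => ⟪B x, u⟫) = fun x => ‖u‖ * ⟪B x, u'⟫ := by
      funext x
      rw [hu', real_inner_smul_right, ← mul_assoc, mul_inv_cancel₀ (norm_ne_zero_iff.2 hu),
        one_mul]
    rw [heq]
    calc eBMOSeminorm (fun x => ‖u‖ * ⟪B x, u'⟫) volume
        ≤ ‖‖u‖‖ₑ * eBMOSeminorm (fun x => ⟪B x, u'⟫) volume :=
          eBMOSeminorm_const_mul_le _ _ _
      _ ≤ ‖‖u‖‖ₑ * eBMOSeminormVec B := by
          gcongr
          exact le_iSup₂_of_le u' hnorm le_rfl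
      _ < ∞ := ENNReal.mul_lt_top enorm_lt_top hBMO

/-- `∫ Δθ = 0` for a test function `θ` on a finite-dimensional inner product space
(`Δθ = div ∇θ` and Gauss–Green without boundary). [folklore] -/
theorem integral_laplacian_eq_zero_of_isTestFunctionOn {E : Type*} [NormedAddCommGroup E]
    [InnerProductSpace ℝ E] [FiniteDimensional ℝ E] [MeasurableSpace E] [BorelSpace E]
    {θ : E → ℝ} (hθ : IsTestFunctionOn (⊤ : Opens E) θ) : ∫ x, (Δ θ) x = 0 := by
  have hθ2 : ContDiff ℝ 2 θ := contDiff_infty.1 hθ.contDiff 2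
  have hgrad : ContDiff ℝ 1 (gradient θ) :=
    (InnerProductSpace.toDual ℝ E).symm.contDiff.comp (hθ2.fderiv_right (m := 1) le_rfl)
  have hgradc : HasCompactSupport (gradient θ) := by
    have h := (hθ.hasCompactSupport.fderiv (𝕜 := ℝ)).comp_left
      (g := fun L => (InnerProductSpace.toDual ℝ E).symm L) (map_zero _)
    exact h
  have h := integral_divergence_eq_zero hgrad hgradc
  simp_rw [divergence_gradient hθ2] at h
  exact h

/-- **A `BMO` stream function kills constants (distributional form).** Let `B : ℝ³ → ℝ³` be
locally integrable with `‖B‖_{BMO} < ∞` (the tree's `eBMOSeminormVec`) and let `b ∈ ℝ³` satisfy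
`curl B = b` in `𝓓'`, in the form `∫ φ ⟪b, e⟫ = ∫ ⟪B × ∇φ, e⟫` for all `φ ∈ C_c^∞`, `e ∈ ℝ³`. Then
`b = 0`. Indeed the constant `⟪b, e⟫` is then the weak divergence of the `BMO` field `B × e`,
and a weakly harmonic element of `BMO⁻¹ = div BMO` vanishes (Liouville in `BMO⁻¹`,
`HasWeakDivergenceRepresentation.ae_eq_zero_of_weaklyHarmonic`; equivalently, testing against a
plateau of radius `R` gives `|b| R³ ≲ ‖B‖_{BMO} R²`). This replaces the harmonic-function argument
at the end of the printed proofs of Theorems 1.2 and 1.4 of Lei–Zhang ("the stream function,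
being a bounded [harmonic] function, is constant; therefore `v = ∇ × B = 0`", arXiv:1011.5066
p. 12), which needs `div B = 0`. [cite: LeiZhang2011, §4, proof of Thm. 1.2 (arXiv p. 12)] -/
theorem eq_zero_of_forall_integral_mul_inner_eq
    {B : EuclideanSpace ℝ (Fin 3) → EuclideanSpace ℝ (Fin 3)} {b : EuclideanSpace ℝ (Fin 3)}
    (hBi : LocallyIntegrable B volume) (hBMO : eBMOSeminormVec B < ∞)
    (h : ∀ (φ : EuclideanSpace ℝ (Fin 3) → ℝ) (e : EuclideanSpace ℝ (Fin 3)),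
      ContDiff ℝ (⊤ : ℕ∞) φ → HasCompactSupport φ →
      ∫ x, φ x * ⟪b, e⟫ = ∫ x, ⟪cross (B x) (gradient φ x), e⟫) :
    b = 0 := by
  suffices key : ∀ e : EuclideanSpace ℝ (Fin 3), ⟪b, e⟫ = 0 by
    have := key b
    rwa [inner_self_eq_zero] at this
  intro e
  -- `⟪b, e⟫ = div (B × e)` weakly
  have hrep : HasWeakDivergenceRepresentation (fun _ : EuclideanSpace ℝ (Fin 3) => ⟪b, e⟫)
      (fun x => cross (B x) e) := by
    refine ⟨locallyIntegrable_const _, ?_, ?_⟩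
    · have : (fun x => cross (B x) e) =
          (crossCLM.flip e : EuclideanSpace ℝ (Fin 3) →L[ℝ] EuclideanSpace ℝ (Fin 3)) ∘ B := by
        funext x; simp [ContinuousLinearMap.flip_apply]
      rw [this]
      have hh := ContinuousLinearMap.locallyIntegrableOn_comp
        (crossCLM.flip e : EuclideanSpace ℝ (Fin 3) →L[ℝ] EuclideanSpace ℝ (Fin 3))
        ((locallyIntegrableOn_univ).mpr hBi)
      rwa [locallyIntegrableOn_univ] at hh
    · intro φ hφ
      have h1 := h φ e hφ.contDiff hφ.hasCompactSupport
      have h2 : ∫ x, ⟪b, e⟫ * φ x = ∫ x, φ x * ⟪b, e⟫ :=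
        integral_congr_ae (Eventually.of_forall fun x => mul_comm _ _)
      rw [h2, h1, ← integral_neg]
      refine integral_congr_ae (Eventually.of_forall fun x => ?_)
      dsimp only
      rw [inner_cross_left_swap]
  have hΦ : ∀ v : EuclideanSpace ℝ (Fin 3), MemBMO (fun x => ⟪cross (B x) e, v⟫) volume := by
    intro v
    have : (fun x => ⟪cross (B x) e, v⟫) = fun x => ⟪B x, cross e v⟫ :=
      funext fun x => (inner_cross_right_eq_inner_cross_left (B x) e v).symm
    rw [this]
    exact memBMO_inner_of_eBMOSeminormVec_lt_top hBi hBMO _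
  have hharm : ∀ θ : EuclideanSpace ℝ (Fin 3) → ℝ,
      IsTestFunctionOn (⊤ : Opens (EuclideanSpace ℝ (Fin 3))) θ →
      ∫ x, (Δ θ) x * ⟪b, e⟫ = 0 := by
    intro θ hθ
    rw [integral_mul_const, integral_laplacian_eq_zero_of_isTestFunctionOn hθ, zero_mul]
  have hae := hrep.ae_eq_zero_of_weaklyHarmonic hΦ hharm
  obtain ⟨x, hx⟩ := hae.exists
  simpa using hx

/-- **`BMO` stream functions rule out constant flows (the tree's stream-function class).** If
`B : ℝ³ → ℝ³` is differentiable, `curl B = b` a.e. for a constant vector `b`, and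
`‖B‖_{BMO} < ∞`, then `b = 0`: by `integral_mul_inner_eq_integral_inner_cross_gradient` the
identity `curl B = b` holds in `𝓓'`, and `eq_zero_of_forall_integral_mul_inner_eq` applies. This is
the last step of the printed proofs of Lei–Zhang's Theorems 1.2 and 1.4 (arXiv:1011.5066 pp. 12–13:
after KNSS Thm. 5.2 resp. 5.1 the ancient solution is `(0, 0, l(t))` resp. `u(t)`, and the `BMO`
stream function forces it to vanish), for the stream functions of `HasBMOStreamFunctionOn`.
[cite: LeiZhang2011, §4, proofs of Thms. 1.2 and 1.4 (arXiv pp. 12–13)] -/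
theorem eq_zero_of_curl_ae_eq_const_of_eBMOSeminormVec_lt_top
    {B : EuclideanSpace ℝ (Fin 3) → EuclideanSpace ℝ (Fin 3)} {b : EuclideanSpace ℝ (Fin 3)}
    (hB : Differentiable ℝ B) (hcurl : curl B =ᵐ[volume] fun _ => b)
    (hBMO : eBMOSeminormVec B < ∞) : b = 0 :=
  eq_zero_of_forall_integral_mul_inner_eq hB.continuous.locallyIntegrable hBMO
    fun _ e hφ hφc => integral_mul_inner_eq_integral_inner_cross_gradient hB hcurl
      (locallyIntegrable_const b) (contDiff_infty.1 hφ 1) hφc e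

/-- **Endgame of Theorems 1.2/1.4 in the class `HasBMOStreamFunctionOn`.** If `u` has a stream
function with `BMO` slices on `S` and at some `t ∈ S` the slice `u t` is a.e. a constant vector
`b`, then `b = 0`. [cite: LeiZhang2011, §4, proofs of Thms. 1.2 and 1.4 (arXiv pp. 12–13)] -/
theorem HasBMOStreamFunctionOn.eq_zero_of_ae_eq_const {S : Set ℝ}
    {u B : ℝ → EuclideanSpace ℝ (Fin 3) → EuclideanSpace ℝ (Fin 3)} {C : ℝ≥0}
    (h : HasBMOStreamFunctionOn S u B C) {t : ℝ} (ht : t ∈ S) {b : EuclideanSpace ℝ (Fin 3)}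
    (hu : u t =ᵐ[volume] fun _ => b) : b = 0 := by
  obtain ⟨hd, hc, hbmo⟩ := h t ht
  exact eq_zero_of_curl_ae_eq_const_of_eBMOSeminormVec_lt_top hd (hc.trans hu)
    (hbmo.trans_lt ENNReal.coe_lt_top)

/-- In the class `HasBMOStreamFunctionOn`, a slice that is a.e. constant in space vanishes a.e.
[cite: LeiZhang2011, §4, proofs of Thms. 1.2 and 1.4 (arXiv pp. 12–13)] -/
theorem HasBMOStreamFunctionOn.ae_eq_zero_of_ae_eq_const {S : Set ℝ}
    {u B : ℝ → EuclideanSpace ℝ (Fin 3) → EuclideanSpace ℝ (Fin 3)} {C : ℝ≥0}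
    (h : HasBMOStreamFunctionOn S u B C) {t : ℝ} (ht : t ∈ S) {b : EuclideanSpace ℝ (Fin 3)}
    (hu : u t =ᵐ[volume] fun _ => b) : u t =ᵐ[volume] 0 := by
  have hb := h.eq_zero_of_ae_eq_const ht hu
  subst hb
  exact hu

/-- **The endgame of both cases of the proof of Theorem 1.4, a.e. in time.** If on a set of
times `S` the slices `u t` are a.e. equal to constant vectors `c t` for a.e. `t ∈ S` (the output
of KNSS Thm. 5.2 in Case 1, `c t = l(t) e_z`, and of KNSS Thm. 5.1 in Case 2,
`c t = u^r(t) ν + u^z(t) e_z`), and `u` has, for a.e. `t ∈ S`, a differentiable stream slice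
with `curl (B t) = u t` a.e. and `‖B t‖_{BMO} ≤ C`, then `u t = 0` a.e. for a.e. `t ∈ S`
("the boundedness of the stream function of `u` in BMO norm implies that `u = 0`",
arXiv:1011.5066 p. 13). [cite: LeiZhang2011, Thm. 1.4, proof §4, Cases 1–2 (arXiv pp. 12–13)] -/
theorem ae_eq_zero_of_ae_eq_const_of_bmoStream {S : Set ℝ}
    {u : ℝ → EuclideanSpace ℝ (Fin 3) → EuclideanSpace ℝ (Fin 3)}
    {c : ℝ → EuclideanSpace ℝ (Fin 3)}
    (hc : ∀ᵐ t ∂(volume.restrict S), u t =ᵐ[volume] fun _ => c t)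
    (hB : ∃ (B : ℝ → EuclideanSpace ℝ (Fin 3) → EuclideanSpace ℝ (Fin 3)) (C : ℝ≥0),
      ∀ᵐ t ∂(volume.restrict S),
        Differentiable ℝ (B t) ∧ curl (B t) =ᵐ[volume] u t ∧ eBMOSeminormVec (B t) ≤ C) :
    ∀ᵐ t ∂(volume.restrict S), u t =ᵐ[volume] 0 := by
  obtain ⟨B, C, hBt⟩ := hB
  filter_upwards [hc, hBt] with t ht ⟨hd, hcurl, hbmo⟩
  have hzero : c t = 0 :=
    eq_zero_of_curl_ae_eq_const_of_eBMOSeminormVec_lt_top hd (hcurl.trans ht)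
      (hbmo.trans_lt ENNReal.coe_lt_top)
  rw [hzero] at ht
  exact ht

end Literature.Analysis.FluidPDE
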